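import Mathlib
import Literature.Analysis.ValidatedNumerics.ExpPoly.CorrelationCert
import HarnessLib

/-!
# One-node certification of a window increment polynomial, I: the correlation polynomial and a Cauchy bound

RH-free helper for the GroundBarta A-layers (`--supports` the parity ladder item); part I of II
(part II: `WeilArchIncrementOneNode.lean`, the kernel certificate `incCheckBig` and its soundness).

* `eq_zero_of_eval_eq_zero_of_coeff_bound` — Cauchy's root bound in the form used by the certificate: if `S • R`
  has integer coefficients of absolute value `≤ B` and `R(t₀) = 0` at a rational `t₀ ≥ B + 2`, then `R = 0`;
* `corrPoly p : ℚ[X]` — the window autocorrelation `C(t) = ∫_{-1}^{1-t} p(x+t) p(x) dx` of a coefficient list `p`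
  written out in `ℚ[X]` (`aeval_corrPoly_eq_eval_corr : corrPoly(t) = eval (Poly.corr p p 1) t`), with the explicit
  common denominator `Sp² · L` (`Sp` clears the denominators of `p`, every `m ≤ 2|p|` divides `L`) and the size bound
  `|Sp² L · coeff_k| ≤ M² L |p|³ 8^{|p|}` (`corrPoly_coeff_int_bound`).

References: Cauchy's bound on polynomial roots; binomial expansion of `(1 − X)^N`. [folklore]
-/

set_option linter.dupNamespace false

open Polynomial Finset

namespace Summit.RiemannHypothesis.RiemannHypothesis.Theorems.IncOneNode

/-! ## A Cauchy root bound over `ℚ` with a common denominator -/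

/-- **Cauchy bound.** If `S • R` has integer coefficients bounded by `B` in absolute value (`S ≥ 1`) and
`R` vanishes at a rational `t₀ ≥ B + 2`, then `R = 0`. [folklore] -/
theorem eq_zero_of_eval_eq_zero_of_coeff_bound (R : ℚ[X]) {S B : ℕ} (hS : 0 < S)
    (hint : ∀ k, ∃ z : ℤ, (z : ℚ) = (S : ℚ) * R.coeff k)
    (hbd : ∀ k, |(S : ℚ) * R.coeff k| ≤ B) {t₀ : ℚ} (ht₀ : (B : ℚ) + 2 ≤ t₀)
    (hev : R.eval t₀ = 0) : R = 0 := by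
  by_contra hR
  set m := R.natDegree with hm
  have hlc : R.coeff m ≠ 0 := by
    rw [hm]; exact Polynomial.leadingCoeff_ne_zero.mpr hR
  -- the scaled leading coefficient is a nonzero integer, hence `≥ 1` in absolute value
  obtain ⟨z, hz⟩ := hint m
  have hz1 : (1 : ℚ) ≤ |(S : ℚ) * R.coeff m| := by
    rw [← hz]
    have hz0 : z ≠ 0 := by
      rintro rfl
      have : (S : ℚ) * R.coeff m = 0 := by rw [← hz]; simp
      rcases mul_eq_zero.1 this with h | h
      · exact absurd h (by exact_mod_cast hS.ne')
      · exact hlc h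
    rw [← Int.cast_abs]
    exact_mod_cast Int.one_le_abs hz0
  have ht1 : (1 : ℚ) < t₀ := by
    have : (0 : ℚ) ≤ B := by positivity
    linarith
  have ht0 : (0 : ℚ) ≤ t₀ := by linarith
  -- `S · R(t₀) = S c_m t₀^m + Σ_{k<m} S c_k t₀^k`
  have hsum : (S : ℚ) * R.eval t₀ =
      (S : ℚ) * R.coeff m * t₀ ^ m + ∑ k ∈ range m, (S : ℚ) * R.coeff k * t₀ ^ k := by
    rw [Polynomial.eval_eq_sum_range, Finset.mul_sum, Finset.sum_range_succ]
    simp only [mul_assoc]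
    ring
  -- the lower part is at most `B · Σ_{k<m} t₀^k ≤ (t₀ − 1) Σ t₀^k = t₀^m − 1 < t₀^m`
  have hlow : |∑ k ∈ range m, (S : ℚ) * R.coeff k * t₀ ^ k| ≤ t₀ ^ m - 1 := by
    calc |∑ k ∈ range m, (S : ℚ) * R.coeff k * t₀ ^ k|
        ≤ ∑ k ∈ range m, |(S : ℚ) * R.coeff k * t₀ ^ k| := Finset.abs_sum_le_sum_abs _ _
      _ ≤ ∑ k ∈ range m, (B : ℚ) * t₀ ^ k := by
          refine Finset.sum_le_sum fun k _ ↦ ?_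
          rw [abs_mul, abs_of_nonneg (pow_nonneg ht0 k)]
          exact mul_le_mul_of_nonneg_right (hbd k) (pow_nonneg ht0 k)
      _ ≤ ∑ k ∈ range m, (t₀ - 1) * t₀ ^ k := by
          refine Finset.sum_le_sum fun k _ ↦ ?_
          exact mul_le_mul_of_nonneg_right (by linarith) (pow_nonneg ht0 k)
      _ = t₀ ^ m - 1 := by
          rw [← Finset.mul_sum, mul_comm, geom_sum_mul]
  have hhigh : t₀ ^ m ≤ |(S : ℚ) * R.coeff m * t₀ ^ m| := by
    rw [abs_mul, abs_of_nonneg (pow_nonneg ht0 m)]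
    exact le_mul_of_one_le_left (pow_nonneg ht0 m) hz1
  have hne : (S : ℚ) * R.eval t₀ ≠ 0 := by
    rw [hsum]
    intro h0
    have h1 : (S : ℚ) * R.coeff m * t₀ ^ m = -(∑ k ∈ range m, (S : ℚ) * R.coeff k * t₀ ^ k) := by
      linarith
    have h2 : |(S : ℚ) * R.coeff m * t₀ ^ m| ≤ t₀ ^ m - 1 := by
      rw [h1, abs_neg]; exact hlow
    linarith
  exact hne (by rw [hev, mul_zero])

/-! ## Coefficients of `(1 − X)^N` -/

/-- `(1 − X)^N = C((−1)^N) · (X + C(−1))^N`. [folklore] -/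
theorem one_sub_X_pow_eq (N : ℕ) :
    ((1 : ℚ[X]) - X) ^ N = C ((-1 : ℚ) ^ N) * (X + C (-1)) ^ N := by
  have h : ((1 : ℚ[X]) - X) = C (-1) * (X + C (-1)) := by
    rw [mul_add, ← C_mul]; norm_num; ring
  rw [h, mul_pow, C_pow]

/-- The integer coefficients of `(1 − X)^N − C((−1)^N)`. [folklore] -/
def qz (N r : ℕ) : ℤ := (-1) ^ N * ((-1) ^ (N - r) * (N.choose r : ℤ)) - if r = 0 then (-1) ^ N else 0

/-- `coeff_r ((1 − X)^N − C((−1)^N)) = qz N r`. [folklore] -/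
theorem coeff_one_sub_X_pow_sub_C (N r : ℕ) :
    (((1 : ℚ[X]) - X) ^ N - C ((-1 : ℚ) ^ N)).coeff r = (qz N r : ℚ) := by
  rw [coeff_sub, one_sub_X_pow_eq, coeff_C_mul, coeff_X_add_C_pow, coeff_C, qz]
  push_cast
  rfl

/-- `|qz N r| ≤ 2^(N+1)`. [folklore] -/
theorem abs_qz_le (N r : ℕ) : |(qz N r : ℚ)| ≤ 2 ^ (N + 1) := by
  have hc : ((N.choose r : ℕ) : ℚ) ≤ 2 ^ N := by
    have h1 : N.choose r ≤ 2 ^ N := by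
      rcases le_or_gt r N with h | h
      · calc N.choose r ≤ ∑ i ∈ range (N + 1), N.choose i :=
            Finset.single_le_sum (fun i _ ↦ Nat.zero_le _) (Finset.mem_range.2 (Nat.lt_succ_of_le h))
          _ = 2 ^ N := Nat.sum_range_choose N
      · rw [Nat.choose_eq_zero_of_lt h]; exact Nat.zero_le _
    exact_mod_cast h1
  unfold qz
  push_cast
  have ha : |(-1 : ℚ) ^ N * ((-1 : ℚ) ^ (N - r) * (N.choose r : ℚ))| ≤ 2 ^ N := by
    rw [abs_mul, abs_mul, abs_pow, abs_pow, abs_neg, abs_one, one_pow, one_pow, one_mul, one_mul,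
      Nat.abs_cast]
    exact hc
  have hb : |(if r = 0 then (-1 : ℚ) ^ N else 0)| ≤ 1 := by
    split_ifs
    · rw [abs_pow, abs_neg, abs_one, one_pow]
    · simp
  calc |(-1 : ℚ) ^ N * ((-1 : ℚ) ^ (N - r) * (N.choose r : ℚ)) - (if r = 0 then (-1 : ℚ) ^ N else 0)|
      ≤ |(-1 : ℚ) ^ N * ((-1 : ℚ) ^ (N - r) * (N.choose r : ℚ))| + |(if r = 0 then (-1 : ℚ) ^ N else 0)| :=
        abs_sub _ _
    _ ≤ 2 ^ N + 1 := add_le_add ha hb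
    _ ≤ 2 ^ (N + 1) := by
        rw [pow_succ]; linarith [one_le_pow₀ (M₀ := ℚ) (a := 2) (n := N) (by norm_num)]


/-! ## The correlation polynomial `C(t) = ∫_{-1}^{1-t} p(x+t) p(x) dx` as an element of `ℚ[X]` -/

section CorrPoly

open Literature.Analysis.ValidatedNumerics.ExpPoly MeasureTheory intervalIntegral

/-- The scalar `p_i p_j C(i,a) / (a+j+1)`. [folklore] -/
def coef (p : Poly) (i j a : ℕ) : ℚ :=
  p.getD i 0 * p.getD j 0 * (i.choose a : ℚ) / ((a + j + 1 : ℕ) : ℚ)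

/-- `(1 − X)^N − C((−1)^N)`. [folklore] -/
noncomputable def qPoly (N : ℕ) : ℚ[X] := ((1 : ℚ[X]) - X) ^ N - C ((-1 : ℚ) ^ N)

/-- One term `coef · X^{i−a} · ((1 − X)^{a+j+1} − C((−1)^{a+j+1}))` of the correlation polynomial. [folklore] -/
noncomputable def corrTerm (p : Poly) (i j a : ℕ) : ℚ[X] :=
  C (coef p i j a) * (X ^ (i - a) * qPoly (a + j + 1))

/-- **The correlation polynomial** of a coefficient list `p` (window `b = 1`):
`Σ_{i,j<|p|} Σ_{a≤i} p_i p_j C(i,a)/(a+j+1) · X^{i−a} ((1−X)^{a+j+1} − (−1)^{a+j+1})`. [folklore] -/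
noncomputable def corrPoly (p : Poly) : ℚ[X] :=
  ∑ i ∈ range p.length, ∑ j ∈ range p.length, ∑ a ∈ range (i + 1), corrTerm p i j a

/-- Expansion of the integrand `p(x+t) p(x)` in monomials of `x`. [folklore] -/
theorem integrand_expand (p : Poly) (t x : ℝ) :
    Poly.eval p (x + t) * Poly.eval p x =
      ∑ i ∈ range p.length, ∑ j ∈ range p.length, ∑ a ∈ range (i + 1),
        ((p.getD i 0 : ℚ) : ℝ) * ((p.getD j 0 : ℚ) : ℝ) * (i.choose a : ℝ) * t ^ (i - a) * x ^ (a + j) := by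
  rw [Poly.eval_eq_sum_getD, Poly.eval_eq_sum_getD, Finset.sum_mul_sum]
  refine Finset.sum_congr rfl fun i _ ↦ Finset.sum_congr rfl fun j _ ↦ ?_
  rw [add_pow]
  simp only [Finset.mul_sum, Finset.sum_mul]
  refine Finset.sum_congr rfl fun a _ ↦ ?_
  rw [pow_add]; ring

/-- The correlation integral, expanded. [folklore] -/
theorem integral_expand (p : Poly) (t : ℝ) :
    ∫ x in (-1 : ℝ)..(1 - t), Poly.eval p (x + t) * Poly.eval p x =
      ∑ i ∈ range p.length, ∑ j ∈ range p.length, ∑ a ∈ range (i + 1),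
        ((p.getD i 0 : ℚ) : ℝ) * ((p.getD j 0 : ℚ) : ℝ) * (i.choose a : ℝ) * t ^ (i - a) *
          (((1 - t) ^ (a + j + 1) - (-1) ^ (a + j + 1)) / ((a + j + 1 : ℕ) : ℝ)) := by
  simp_rw [integrand_expand]
  have hcont : ∀ (i j a : ℕ), Continuous fun x : ℝ ↦
      ((p.getD i 0 : ℚ) : ℝ) * ((p.getD j 0 : ℚ) : ℝ) * (i.choose a : ℝ) * t ^ (i - a) * x ^ (a + j) :=
    fun i j a ↦ continuous_const.mul (continuous_pow (a + j))
  rw [intervalIntegral.integral_finsetSum fun i _ ↦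
    (continuous_finsetSum _ fun j _ ↦ continuous_finsetSum _ fun a _ ↦ hcont i j a).intervalIntegrable _ _]
  refine Finset.sum_congr rfl fun i _ ↦ ?_
  rw [intervalIntegral.integral_finsetSum fun j _ ↦
    (continuous_finsetSum _ fun a _ ↦ hcont i j a).intervalIntegrable _ _]
  refine Finset.sum_congr rfl fun j _ ↦ ?_
  rw [intervalIntegral.integral_finsetSum fun a _ ↦ (hcont i j a).intervalIntegrable _ _]
  refine Finset.sum_congr rfl fun a _ ↦ ?_
  rw [intervalIntegral.integral_const_mul, integral_pow]
  push_cast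
  ring

/-- Real evaluation of one term. [folklore] -/
theorem aeval_corrTerm (p : Poly) (i j a : ℕ) (t : ℝ) :
    aeval t (corrTerm p i j a) =
      ((coef p i j a : ℚ) : ℝ) * (t ^ (i - a) * ((1 - t) ^ (a + j + 1) - (-1) ^ (a + j + 1))) := by
  simp [corrTerm, qPoly, map_mul, map_sub, map_pow, aeval_X, aeval_C]

/-- **`corrPoly` evaluates to the correlation integral**: `corrPoly(t) = ∫_{-1}^{1-t} p(x+t)p(x) dx`. [folklore] -/
theorem aeval_corrPoly (p : Poly) (t : ℝ) :
    aeval t (corrPoly p) = ∫ x in (-1 : ℝ)..(1 - t), Poly.eval p (x + t) * Poly.eval p x := by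
  rw [integral_expand]
  simp only [corrPoly, map_sum, aeval_corrTerm]
  refine Finset.sum_congr rfl fun i _ ↦ Finset.sum_congr rfl fun j _ ↦ Finset.sum_congr rfl fun a _ ↦ ?_
  simp only [coef]
  push_cast
  ring

/-- `corrPoly(t) = eval (corr p p 1) t`. [folklore] -/
theorem aeval_corrPoly_eq_eval_corr (p : Poly) (t : ℝ) :
    aeval t (corrPoly p) = Poly.eval (Poly.corr p p 1) t := by
  rw [aeval_corrPoly, Poly.eval_corr]
  push_cast
  rfl

/-! ### Coefficients of `corrPoly`: common denominator and size -/

/-- Coefficient of one term. [folklore] -/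
theorem coeff_corrTerm (p : Poly) (i j a k : ℕ) :
    (corrTerm p i j a).coeff k =
      coef p i j a * (if i - a ≤ k then (qz (a + j + 1) (k - (i - a)) : ℚ) else 0) := by
  rw [corrTerm, coeff_C_mul, coeff_X_pow_mul']
  split_ifs with h
  · rw [qPoly, coeff_one_sub_X_pow_sub_C]
  · rfl

/-- Coefficient of the sum. [folklore] -/
theorem coeff_corrPoly (p : Poly) (k : ℕ) :
    (corrPoly p).coeff k =
      ∑ i ∈ range p.length, ∑ j ∈ range p.length, ∑ a ∈ range (i + 1), (corrTerm p i j a).coeff k := by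
  simp only [corrPoly, finsetSum_coeff]

/-- **Per-term integrality and size.** With `S = Sp² · L`, where `Sp` clears the denominators of `p`
(`|p_i| Sp ≤ M`) and every `m ≤ 2|p|` divides `L`: `S · coeff_k(term) ∈ ℤ` and `|S · coeff_k(term)| ≤ M² L 8^{|p|}`.
[folklore] -/
theorem corrTerm_coeff_int_bound {p : Poly} {Sp L M : ℕ}
    (hp : ∀ i, i < p.length → (∃ z : ℤ, (z : ℚ) = p.getD i 0 * Sp) ∧ |p.getD i 0| * Sp ≤ M)
    (hL : ∀ m, 1 ≤ m → m ≤ 2 * p.length → m ∣ L) {i j a : ℕ} (hi : i < p.length) (hj : j < p.length)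
    (ha : a ≤ i) (k : ℕ) :
    (∃ z : ℤ, (z : ℚ) = ((Sp : ℚ) ^ 2 * L) * (corrTerm p i j a).coeff k) ∧
      |((Sp : ℚ) ^ 2 * L) * (corrTerm p i j a).coeff k| ≤ (M : ℚ) ^ 2 * L * 8 ^ p.length := by
  obtain ⟨⟨zi, hzi⟩, hbi⟩ := hp i hi
  obtain ⟨⟨zj, hzj⟩, hbj⟩ := hp j hj
  have hN1 : 1 ≤ a + j + 1 := by omega
  have hN2 : a + j + 1 ≤ 2 * p.length := by omega
  obtain ⟨q, hq⟩ := hL (a + j + 1) hN1 hN2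
  have hNpos : ((a + j + 1 : ℕ) : ℚ) ≠ 0 := by positivity
  have hLq : (L : ℚ) / ((a + j + 1 : ℕ) : ℚ) = (q : ℚ) := by
    rw [div_eq_iff hNpos, hq]; push_cast; ring
  -- the scaled coefficient, factored
  set w : ℚ := (if i - a ≤ k then (qz (a + j + 1) (k - (i - a)) : ℚ) else 0) with hw
  have key : ((Sp : ℚ) ^ 2 * L) * (corrTerm p i j a).coeff k =
      (p.getD i 0 * Sp) * (p.getD j 0 * Sp) * (i.choose a : ℚ) * ((L : ℚ) / ((a + j + 1 : ℕ) : ℚ)) * w := by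
    rw [coeff_corrTerm, coef, ← hw]
    field_simp
  rw [key, hLq, ← hzi, ← hzj]
  -- integrality and size of `w`
  have hwint : ∃ zw : ℤ, (zw : ℚ) = w ∧ |(zw : ℚ)| ≤ 4 ^ p.length := by
    rw [hw]
    split_ifs with h
    · refine ⟨qz (a + j + 1) (k - (i - a)), rfl, (abs_qz_le _ _).trans ?_⟩
      calc (2 : ℚ) ^ (a + j + 1 + 1) ≤ 2 ^ (2 * p.length) := pow_le_pow_right₀ (by norm_num) (by omega)
        _ = 4 ^ p.length := by rw [pow_mul]; norm_num
    · exact ⟨0, by simp, by simp⟩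
  obtain ⟨zw, hzw, hzwb⟩ := hwint
  rw [← hzw]
  refine ⟨⟨zi * zj * (i.choose a : ℤ) * (q : ℤ) * zw, by push_cast; ring⟩, ?_⟩
  -- size
  have hzi' : |(zi : ℚ)| ≤ M := by rw [hzi, abs_mul, Nat.abs_cast]; exact hbi
  have hzj' : |(zj : ℚ)| ≤ M := by rw [hzj, abs_mul, Nat.abs_cast]; exact hbj
  have hch : ((i.choose a : ℕ) : ℚ) ≤ 2 ^ p.length := by
    have h1 : i.choose a ≤ 2 ^ i :=
      calc i.choose a ≤ ∑ l ∈ range (i + 1), i.choose l :=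
          Finset.single_le_sum (fun l _ ↦ Nat.zero_le _) (Finset.mem_range.2 (Nat.lt_succ_of_le ha))
        _ = 2 ^ i := Nat.sum_range_choose i
    have h2 : (2 : ℕ) ^ i ≤ 2 ^ p.length := Nat.pow_le_pow_right (by norm_num) hi.le
    exact_mod_cast h1.trans h2
  have hqL : (q : ℚ) ≤ L := by
    have : q ≤ L := by
      rcases Nat.eq_zero_or_pos q with h0 | h0
      · rw [h0]; exact Nat.zero_le _
      · calc q ≤ (a + j + 1) * q := Nat.le_mul_of_pos_left q (by omega)
          _ = L := hq.symm
    exact_mod_cast this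
  have hM : (0 : ℚ) ≤ M := by positivity
  calc |(zi : ℚ) * zj * (i.choose a : ℕ) * (q : ℚ) * zw|
      = |(zi : ℚ)| * |(zj : ℚ)| * (i.choose a : ℕ) * (q : ℚ) * |(zw : ℚ)| := by
        rw [abs_mul, abs_mul, abs_mul, abs_mul, Nat.abs_cast, Nat.abs_cast]
    _ ≤ (M : ℚ) * M * 2 ^ p.length * L * 4 ^ p.length := by
        gcongr
    _ = (M : ℚ) ^ 2 * L * 8 ^ p.length := by
        have : (8 : ℚ) ^ p.length = 2 ^ p.length * 4 ^ p.length := by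
          rw [← mul_pow]; norm_num
        rw [this]; ring

/-- **Integrality and size of the scaled coefficients of `corrPoly`.** [folklore] -/
theorem corrPoly_coeff_int_bound {p : Poly} {Sp L M : ℕ}
    (hp : ∀ i, i < p.length → (∃ z : ℤ, (z : ℚ) = p.getD i 0 * Sp) ∧ |p.getD i 0| * Sp ≤ M)
    (hL : ∀ m, 1 ≤ m → m ≤ 2 * p.length → m ∣ L) (k : ℕ) :
    (∃ z : ℤ, (z : ℚ) = ((Sp : ℚ) ^ 2 * L) * (corrPoly p).coeff k) ∧
      |((Sp : ℚ) ^ 2 * L) * (corrPoly p).coeff k| ≤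
        (M : ℚ) ^ 2 * L * (p.length : ℚ) ^ 3 * 8 ^ p.length := by
  rw [coeff_corrPoly, Finset.mul_sum]
  simp_rw [Finset.mul_sum]
  constructor
  · -- integrality: a sum of integers
    have : ∀ i ∈ range p.length, ∀ j ∈ range p.length, ∀ a ∈ range (i + 1),
        ∃ z : ℤ, (z : ℚ) = ((Sp : ℚ) ^ 2 * L) * (corrTerm p i j a).coeff k := fun i hi j hj a ha ↦
      (corrTerm_coeff_int_bound hp hL (Finset.mem_range.1 hi) (Finset.mem_range.1 hj)
        (Nat.lt_succ_iff.1 (Finset.mem_range.1 ha)) k).1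
    choose! z hz using this
    refine ⟨∑ i ∈ range p.length, ∑ j ∈ range p.length, ∑ a ∈ range (i + 1), z i j a, ?_⟩
    push_cast
    exact Finset.sum_congr rfl fun i hi ↦ Finset.sum_congr rfl fun j hj ↦
      Finset.sum_congr rfl fun a ha ↦ hz i hi j hj a ha
  · -- size: `len · len · len` terms of size `≤ M² L 8^len`
    have hT : ∀ i ∈ range p.length, ∀ j ∈ range p.length, ∀ a ∈ range (i + 1),
        |((Sp : ℚ) ^ 2 * L) * (corrTerm p i j a).coeff k| ≤ (M : ℚ) ^ 2 * L * 8 ^ p.length :=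
      fun i hi j hj a ha ↦ (corrTerm_coeff_int_bound hp hL (Finset.mem_range.1 hi) (Finset.mem_range.1 hj)
        (Nat.lt_succ_iff.1 (Finset.mem_range.1 ha)) k).2
    have hT0 : (0 : ℚ) ≤ (M : ℚ) ^ 2 * L * 8 ^ p.length := by positivity
    calc |∑ i ∈ range p.length, ∑ j ∈ range p.length, ∑ a ∈ range (i + 1),
            ((Sp : ℚ) ^ 2 * L) * (corrTerm p i j a).coeff k|
        ≤ ∑ i ∈ range p.length, ∑ j ∈ range p.length, ∑ a ∈ range (i + 1),
            |((Sp : ℚ) ^ 2 * L) * (corrTerm p i j a).coeff k| := by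
          refine (Finset.abs_sum_le_sum_abs _ _).trans (Finset.sum_le_sum fun i _ ↦ ?_)
          refine (Finset.abs_sum_le_sum_abs _ _).trans (Finset.sum_le_sum fun j _ ↦ ?_)
          exact Finset.abs_sum_le_sum_abs _ _
      _ ≤ ∑ i ∈ range p.length, ∑ j ∈ range p.length, ∑ a ∈ range (i + 1),
            (M : ℚ) ^ 2 * L * 8 ^ p.length :=
          Finset.sum_le_sum fun i hi ↦ Finset.sum_le_sum fun j hj ↦ Finset.sum_le_sum fun a ha ↦
            hT i hi j hj a ha
      _ ≤ ∑ i ∈ range p.length, ∑ j ∈ range p.length, ∑ a ∈ range p.length,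
            (M : ℚ) ^ 2 * L * 8 ^ p.length := by
          refine Finset.sum_le_sum fun i hi ↦ Finset.sum_le_sum fun j _ ↦ ?_
          exact Finset.sum_le_sum_of_subset_of_nonneg
            (Finset.range_mono (Finset.mem_range.1 hi)) fun _ _ _ ↦ hT0
      _ = (M : ℚ) ^ 2 * L * (p.length : ℚ) ^ 3 * 8 ^ p.length := by
          simp only [Finset.sum_const, Finset.card_range, nsmul_eq_mul]
          ring

end CorrPoly

end Summit.RiemannHypothesis.RiemannHypothesis.Theorems.IncOneNode
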